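import Summits.KontsevichZagierPeriods.KontsevichZagierPeriods.Theorems.SymplecticScissorsRealOnePeriodRelationsStubCellsAux
import Mathlib.Analysis.SpecialFunctions.Sqrt

/-!
# `RealOnePeriodRelations` (stmt-KontsevichZagierPeriods-10042), line `nash-retraction-thin-strip`,
# reshape 4 (the unconditional elliptic layer): the stub `stub_ellTail`

`EllipticLayer.stub_ellTail`: a convergent TAIL `∫_M^∞ c₀ dx/√f(x)` of an abelian integral of the first
kind on `y² = f(x) = x³ + Ax + B` (`e` the largest real root of `f`, `f > 0` on `(e, ∞)`,
`f′(e) = 3e² + A > 0`, `M > e`) is, modulo `M₁`, the COMPLETE integral of the same integrand over the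
bounded cell `(e, e + f′(e)/(M − e))`. Translation by the `2`-torsion point `(e, 0)` acts on abscissae
by the real Möbius map `φ(x) = e + f′(e)/(x − e)`, a decreasing bijection `(M, ∞) → (e, φ(M))` with
`φ′(x) = −f′(e)/(x − e)²`, and the exact polynomial identity
`f(φ(x)) · (x − e)⁴ = f′(e)² · f(x)` (from `f(X) = (X − e)(X² + eX + e² + A)`) gives
`c₀/√f(x) = (c₀/√f(φ x)) · |φ′(x)|`. So the statement is ONE instance of Kontsevich–Zagier's rule (2)
in dimension one, i.e. of the landed packaging `helper_cells_1`: `φ`, `φ′` are `ℚ`-semialgebraic on the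
domain because `e` and `3e² + A` are real algebraic numbers.

References: M. Kontsevich, D. Zagier, *Periods* (2001), §1.2 rule (2).
-/

noncomputable section

open Set MeasureTheory Filter Topology
open Literature.NumberTheory.Transcendental Literature.ModelTheory.ExponentialFields
open Summit.KontsevichZagierPeriods.SymplecticScissors.RealOnePeriodRelationsNegative (M₁ H₁)

namespace Summit.KontsevichZagierPeriods.SymplecticScissors.RealOnePeriodRelations

namespace EllipticLayer

/-- The polynomial identity behind the `2`-torsion translation: if `f(e) = 0` for
`f(X) = X³ + AX + B`, then `f(e + f′(e)/(x − e)) = (f′(e)/(x − e)²)² · f(x)` for `x ≠ e`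
(write `f(X) = (X − e)(X² + eX + e² + A)`). [folklore] -/
theorem ellTail_identity {A B e x : ℝ} (hfe : e ^ 3 + A * e + B = 0) (hx : x ≠ e) :
    (e + (3 * e ^ 2 + A) / (x - e)) ^ 3 + A * (e + (3 * e ^ 2 + A) / (x - e)) + B =
      ((3 * e ^ 2 + A) / (x - e) ^ 2) ^ 2 * (x ^ 3 + A * x + B) := by
  have hB : B = -(e ^ 3) - A * e := by linarith
  subst hB
  have hxe : x - e ≠ 0 := sub_ne_zero.mpr hx
  field_simp
  ring

/-- Square roots of the identity `ellTail_identity` on `(e, ∞)`: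
`√f(e + f′(e)/(x − e)) = f′(e)/(x − e)² · √f(x)` when `f′(e) > 0` and `x > e`. [folklore] -/
theorem ellTail_sqrt {A B e x : ℝ} (hfe : e ^ 3 + A * e + B = 0) (hD : 0 < 3 * e ^ 2 + A)
    (hx : e < x) :
    Real.sqrt ((e + (3 * e ^ 2 + A) / (x - e)) ^ 3 + A * (e + (3 * e ^ 2 + A) / (x - e)) + B) =
      (3 * e ^ 2 + A) / (x - e) ^ 2 * Real.sqrt (x ^ 3 + A * x + B) := by
  rw [ellTail_identity hfe hx.ne', Real.sqrt_mul (sq_nonneg _),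
    Real.sqrt_sq (div_pos hD (pow_pos (sub_pos.2 hx) 2)).le]

/-- **Stub `stub_ellTail` — convergent tails are complete integrals** (rule 2). For real algebraic
`A, B, e, M, c₀` with `f(e) = 0`, `f′(e) = 3e² + A > 0`, `e < M` and `f > 0` on `(e, ∞)`
(`f = X³ + AX + B`), a representation on `{M < z 0}` with integrand `c₀/√f` differs by an element of
`M₁` from a representation on `{z 0 ∈ (e, e + f′(e)/(M − e))}` with integrand `c₀/√f`: push forward
along the real Möbius map `x ↦ e + f′(e)/(x − e)` (translation by the `2`-torsion point `(e, 0)`),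
using `helper_cells_1` and `dx/√f(x) = |dx′|/√f(x′)`. [cite: KontsevichZagier2001, §1.2 rule (2)] -/
theorem stub_ellTail : ∀ (A B e M c₀ : ℝ), IsAlgebraic ℚ A → IsAlgebraic ℚ B → IsAlgebraic ℚ e → IsAlgebraic ℚ M →
    IsAlgebraic ℚ c₀ → e ^ 3 + A * e + B = 0 → 0 < 3 * e ^ 2 + A → e < M →
    (∀ x : ℝ, e < x → 0 < x ^ 3 + A * x + B) →
    ∀ r : KZ.IntegralRep 1, r.domain = {z | M < z 0} →
    (∀ z ∈ r.domain, r.integrand z = c₀ / Real.sqrt ((z 0) ^ 3 + A * (z 0) + B)) →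
    ∃ r' : KZ.IntegralRep 1, r'.domain = {z | z 0 ∈ Set.Ioo e (e + (3 * e ^ 2 + A) / (M - e))} ∧
      (∀ z ∈ r'.domain, r'.integrand z = c₀ / Real.sqrt ((z 0) ^ 3 + A * (z 0) + B)) ∧
      KZ.of r - KZ.of r' ∈ M₁ := by
  intro A B e M c₀ hA _hB he _hM _hc₀ hfe hD heM _hpos r hdom hint
  have hσ := r.isSemialgebraic_domain
  have hmem : ∀ p ∈ r.domain, M < p 0 := fun p hp => by rw [hdom] at hp; exact hp
  have hgt : ∀ p ∈ r.domain, e < p 0 := fun p hp => heM.trans (hmem p hp)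
  have hMe : 0 < M - e := sub_pos.2 heM
  have hDalg : IsAlgebraic ℚ (3 * e ^ 2 + A) := ((isAlgebraic_nat 3).mul (he.pow 2)).add hA
  -- the chart `φ x = e + f′(e)/(x − e)` and its derivative `φ′ x = −f′(e)/(x − e)²` are semialgebraic
  have h1 : IsSemialgebraicFunOn ℚ r.domain (fun p => p 0 - e) :=
    (isSemialgebraicFunOn_apply hσ 0).fun_sub (isSemialgebraicFunOn_const_of_isAlgebraic hσ he)
  have hφ : IsSemialgebraicFunOn ℚ r.domain (fun p => e + (3 * e ^ 2 + A) / (p 0 - e)) :=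
    ((isSemialgebraicFunOn_const_of_isAlgebraic hσ he).fun_add
      ((isSemialgebraicFunOn_const_of_isAlgebraic hσ hDalg).fun_mul h1.fun_inv)).congr
      fun p _ => by rw [div_eq_mul_inv]
  have hφ' : IsSemialgebraicFunOn ℚ r.domain (fun p => -((3 * e ^ 2 + A) / (p 0 - e) ^ 2)) :=
    ((isSemialgebraicFunOn_const_of_isAlgebraic hσ hDalg).fun_mul (h1.fun_pow 2).fun_inv).fun_neg.congr
      fun p _ => by rw [div_eq_mul_inv]
  have hder : ∀ p ∈ r.domain, HasDerivAt (fun t : ℝ => e + (3 * e ^ 2 + A) / (t - e))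
      (-((3 * e ^ 2 + A) / (p 0 - e) ^ 2)) (p 0) := by
    intro p hp
    have hne : p 0 - e ≠ 0 := (sub_pos.2 (hgt p hp)).ne'
    refine (((hasDerivAt_const (p 0) (3 * e ^ 2 + A)).div ((hasDerivAt_id' (p 0)).sub_const e)
      hne).const_add e).congr_deriv ?_
    ring
  have hne : ∀ p ∈ r.domain, -((3 * e ^ 2 + A) / (p 0 - e) ^ 2) ≠ 0 := fun p hp =>
    neg_ne_zero.2 (div_pos hD (pow_pos (sub_pos.2 (hgt p hp)) 2)).ne'
  have hinj : InjOn (fun p : Fin 1 → ℝ => fun _ : Fin 1 => e + (3 * e ^ 2 + A) / (p 0 - e)) r.domain := by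
    intro p hp p' hp' h
    have h0 : e + (3 * e ^ 2 + A) / (p 0 - e) = e + (3 * e ^ 2 + A) / (p' 0 - e) := congrFun h 0
    have ha : 0 < p 0 - e := sub_pos.2 (hgt p hp)
    have hb : 0 < p' 0 - e := sub_pos.2 (hgt p' hp')
    have h2 : (3 * e ^ 2 + A) / (p 0 - e) = (3 * e ^ 2 + A) / (p' 0 - e) := add_left_cancel h0
    rw [div_eq_div_iff ha.ne' hb.ne'] at h2
    have h3 : p' 0 - e = p 0 - e := mul_left_cancel₀ hD.ne' h2
    have : p 0 = p' 0 := by linarith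
    rw [KZ.eq_const_apply_zero p, KZ.eq_const_apply_zero p', this]
  obtain ⟨s, hs, hsi, hrel⟩ := helper_cells_1 r (fun t => e + (3 * e ^ 2 + A) / (t - e))
    (fun t => -((3 * e ^ 2 + A) / (t - e) ^ 2)) hφ hφ' hder hne hinj
  refine ⟨s, ?_, ?_, hrel⟩
  · -- the image of `(M, ∞)` is `(e, e + f′(e)/(M − e))`
    rw [hs]
    ext z
    constructor
    · rintro ⟨p, hp, rfl⟩
      have ha : 0 < p 0 - e := sub_pos.2 (hgt p hp)
      have hlt : M - e < p 0 - e := by linarith [hmem p hp]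
      have hlt' := div_lt_div_of_pos_left hD hMe hlt
      exact ⟨lt_add_of_pos_right e (div_pos hD ha), by linarith⟩
    · intro hz
      have hw : 0 < z 0 - e := sub_pos.2 hz.1
      have hx : M < e + (3 * e ^ 2 + A) / (z 0 - e) := by
        have h2 : z 0 - e < (3 * e ^ 2 + A) / (M - e) := by linarith [hz.2]
        have h3 : M - e < (3 * e ^ 2 + A) / (z 0 - e) := by
          rw [lt_div_iff₀ hw]
          calc (M - e) * (z 0 - e) < (M - e) * ((3 * e ^ 2 + A) / (M - e)) :=
                mul_lt_mul_of_pos_left h2 hMe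
            _ = 3 * e ^ 2 + A := mul_div_cancel₀ _ hMe.ne'
        linarith
      refine ⟨fun _ => e + (3 * e ^ 2 + A) / (z 0 - e), by rw [hdom]; exact hx, ?_⟩
      rw [KZ.eq_const_apply_zero z]
      funext i
      show e + (3 * e ^ 2 + A) / (e + (3 * e ^ 2 + A) / (z 0 - e) - e) = z 0
      rw [add_sub_cancel_left, div_div_cancel₀ hD.ne', add_sub_cancel]
  · -- the integrand of the push-forward is again `c₀/√f`
    intro z hz
    rw [hs] at hz
    obtain ⟨p, hp, rfl⟩ := hz
    have hx : e < p 0 := hgt p hp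
    show s.integrand (fun _ => e + (3 * e ^ 2 + A) / (p 0 - e)) =
      c₀ / Real.sqrt ((e + (3 * e ^ 2 + A) / (p 0 - e)) ^ 3 + A * (e + (3 * e ^ 2 + A) / (p 0 - e)) + B)
    rw [hsi p hp, hint p hp, ellTail_sqrt hfe hD hx, abs_neg,
      abs_of_pos (div_pos hD (pow_pos (sub_pos.2 hx) 2)), div_div, mul_comm]

end EllipticLayer

end Summit.KontsevichZagierPeriods.SymplecticScissors.RealOnePeriodRelations

end
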